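import Mathlib
import HarnessLib

/-!
# Crux `NoZenoR` (stmt-ResolutionOfSingularities-19943), line `sandwich-cluster`, G-layer:
# the `𝒪_X`-submodule of a constant sheaf generated by a set of vectors (full sheaves `M~ = π^*M/torsion`)

OURS (cell res-hironaka, chain W4.4; KERNEL-L0 §16 RULING R1 «tree scheme side»; CHAIN v6.2 §2 / §16 R6
row G2 «full-sheaf package», seat res-D-pv-045 AS res-L0-w44-stub-8). Nothing of [claim: Hironaka2017]
is used.

THE OBJECT of the G-layer (CRUX-PLAN v4.0.2 §1.2; Artin–Verdier 1985 p. 79 «`M~` = `π^*M/(𝔪-torsion)`»;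
the tree's `Literature.AlgebraicGeometry.Resolution.IsChernDivisorOfFullSheaf` describes it in words:
«the full sheaf `M~ = π^*M/torsion` is the subsheaf `U ↦ 𝒪_{X̃}(U)·M` of `K^r`»). For an INTEGRAL scheme
`X` with function field `K(X)`, a `K(X)`-vector space `V` (e.g. `K(X)^r`) and ANY subset `S ⊆ V`, this
file constructs the sheaf of `𝒪_X`-modules

  `𝒪_X · S ⊆ V_X` :  `U ↦ { v ∈ V : v ∈ 𝒪_{X,x} · S for every x ∈ U }`   (`U ≠ ∅`; `0` on `∅`),

the `𝒪_X`-submodule of the constant sheaf `V_X` generated by `S` — as an honest object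
`generatedSheaf V S : X.Modules` (Mathlib `SheafOfModules` over `𝒪_X`), so that the tree's Čech
cohomology `CechMH1`, `sheafHom`, `dual`, `Coh`, `IsFiniteLocallyFree` all apply to it. Sections over
`U` are modelled as functions `↥U → V` that are CONSTANT and take their value in the stalk lattice
`𝒪_{X,x} · S` (`stalkSpan`) at every point (`latticeSubmodule`); the function model makes `Γ(∅) = 0`
and the restriction maps automatic, and the sheaf condition is the gluing of functions plus the
irreducibility of `X` (two non-empty opens meet, so the glued function is again constant).
Cases: `V = K(X)`, `S = ι(I)` for an ideal `I` of a ring `T` mapping to `K(X)` gives the ideal sheaf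
`I · 𝒪_X` (the object of G4′ «`ca(T)·𝒪_{X_min}` invertible»); `V = K(X)^r`, `S = φ(M)` for a
torsion-free `T`-module `M ↪ K^r` gives the full sheaf `M~`.

* `stalkModule`, `stalkSpan V S x` — `V` as an `𝒪_{X,x}`-module through `𝒪_{X,x} → K(X)`, and the
  lattice `𝒪_{X,x} · S`;
* `evalFn U x : Γ(X, U) →+* K(X)` (through the stalk at `x ∈ U`; independent of `x`,
  `evalFn_eq_evalFn`); `fnModule` — `Γ(X, U)` acting on functions `↥U → V` pointwise;
* `latticeSubmodule V S U` — the constant lattice-valued functions, a `Γ(X, U)`-submodule;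
  `latticeRestrict` — restriction, semilinear (`latticeRestrict_smul`);
* `generatedPresheafAb`, `generatedPresheaf`, `generatedPresheafAb_isSheaf`,
  **`generatedSheaf V S : X.Modules`**;
* section calculus: `fn` (the underlying function), `fn_apply_eq_fn_apply` (constancy),
  `fn_mem_stalkSpan`, `section_ext`, `fn_map` (restriction), `fn_add`, `fn_smul`, and the constructor
  `mkSection U v hv` of the section with constant value `v` (`fn_mkSection`, `eq_mkSection`).

Everything is proved; no named facts. [this work]

References: M. Artin, J.-L. Verdier, Math. Ann. 270 (1985) 79–82, p. 79 [`ArtinVerdier1985`];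
U. Görtz, T. Wedhorn, *Algebraic Geometry I*, 2nd ed. (2020), (11.9) (subsheaves of the constant sheaf
`𝒦_X`) and Prop. 3.29 [`GortzWedhorn2020`].
-/

-- single-problem summit: the doubled namespace component `ResolutionOfSingularities` is forced
set_option linter.dupNamespace false

noncomputable section

universe u

open CategoryTheory AlgebraicGeometry TopologicalSpace Opposite

namespace Summit.ResolutionOfSingularities.ResolutionOfSingularities.Theorems.NoZeno.SandwichCluster.FullSheaf

variable {X : Scheme.{u}} [IsIntegral X]
variable (V : Type u) [AddCommGroup V] [Module X.functionField V] (S : Set V)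

/-! ## Stalk lattices -/

/-- `V` as an `𝒪_{X,x}`-module through `𝒪_{X,x} → K(X)` (Mathlib `stalkFunctionFieldAlgebra`).
[folklore] -/
@[reducible]
def stalkModule (x : X) : Module (X.presheaf.stalk x) V :=
  Module.compHom V (algebraMap (X.presheaf.stalk x) X.functionField)

attribute [local instance] stalkModule

/-- Unfolding of the `𝒪_{X,x}`-action on `V`. [folklore] -/
theorem stalk_smul_def (x : X) (t : X.presheaf.stalk x) (v : V) :
    t • v = algebraMap (X.presheaf.stalk x) X.functionField t • v := rfl

/-- `𝒪_{X,x} → K(X) → End V` is a scalar tower. [folklore] -/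
theorem stalk_isScalarTower (x : X) : IsScalarTower (X.presheaf.stalk x) X.functionField V :=
  ⟨fun t k v => by
    change (t • k) • v = algebraMap (X.presheaf.stalk x) X.functionField t • (k • v)
    rw [Algebra.smul_def, mul_smul]⟩

attribute [local instance] stalk_isScalarTower

/-- **The stalk lattice `𝒪_{X,x} · S ⊆ V`**: the `𝒪_{X,x}`-submodule of `V` generated by `S` (for
`S = φ(M)`, `M` a `T`-module and `𝒪_{X,x} ⊇ T`, this is `𝒪_{X,x} · M`, the stalk at `x` of the full
sheaf). [cite: ArtinVerdier1985, p. 79] -/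
def stalkSpan (x : X) : Submodule (X.presheaf.stalk x) V :=
  Submodule.span (X.presheaf.stalk x) S

/-- `S` lies in every stalk lattice. [folklore] -/
theorem subset_stalkSpan (x : X) : S ⊆ (stalkSpan V S x : Set V) :=
  Submodule.subset_span

/-! ## Functions on the points of an open, as a `Γ(X, U)`-module -/

/-- Evaluation `Γ(X, U) → 𝒪_{X,x} → K(X)` at a point `x ∈ U`. [folklore] -/
def evalFn (U : X.Opens) (x : U) : Γ(X, U) →+* X.functionField :=
  (algebraMap (X.presheaf.stalk x.1) X.functionField).comp (X.presheaf.germ U x.1 x.2).hom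

/-- Unfolding of `evalFn`. [folklore] -/
theorem evalFn_apply (U : X.Opens) (x : U) (g : Γ(X, U)) :
    evalFn U x g = algebraMap (X.presheaf.stalk x.1) X.functionField (X.presheaf.germ U x.1 x.2 g) :=
  rfl

/-- `evalFn U x` is the restriction `Γ(X, U) → K(X)` to the generic point; in particular it does
not depend on `x`. [folklore] -/
theorem evalFn_eq_germToFunctionField (U : X.Opens) (x : U) (g : Γ(X, U)) :
    evalFn U x g = (haveI : Nonempty U := ⟨x⟩; X.germToFunctionField U g) := by
  haveI : Nonempty U := ⟨x⟩
  rw [evalFn_apply, Scheme.algebraMap_germ_eq_germToFunctionField]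

/-- Independence of the point. [folklore] -/
theorem evalFn_eq_evalFn (U : X.Opens) (x y : U) (g : Γ(X, U)) : evalFn U x g = evalFn U y g := by
  rw [evalFn_eq_germToFunctionField, evalFn_eq_germToFunctionField]

/-- Compatibility of `evalFn` with restriction of functions. [folklore] -/
theorem evalFn_map {U U' : X.Opens} (i : U' ≤ U) (x : U') (g : Γ(X, U)) :
    evalFn U' x (X.presheaf.map (homOfLE i).op g) = evalFn U ⟨x.1, i x.2⟩ g := by
  rw [evalFn_apply, evalFn_apply]
  congr 1
  exact ConcreteCategory.congr_hom (X.presheaf.germ_res (homOfLE i) x.1 x.2) g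

/-- `evalFn` is injective (`X` integral). [folklore] -/
theorem evalFn_injective (U : X.Opens) (x : U) : Function.Injective (evalFn U x) := by
  intro g g' h
  haveI : Nonempty U := ⟨x⟩
  rw [evalFn_eq_germToFunctionField, evalFn_eq_germToFunctionField] at h
  exact Scheme.germToFunctionField_injective X U h

/-- The `Γ(X, U)`-module of all functions `↥U → V`, `Γ(X, U)` acting at `x` through
`evalFn U x : Γ(X, U) → K(X)`. [folklore] -/
@[reducible]
def fnModule (U : X.Opens) : Module Γ(X, U) (U → V) :=
  Module.compHom (U → V) (RingHom.pi fun x : U => evalFn U x)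

attribute [local instance] fnModule

/-- Unfolding of the action on functions: `(g • s) x = g(x) • s x`. [folklore] -/
theorem fn_smul_apply (U : X.Opens) (g : Γ(X, U)) (s : U → V) (x : U) :
    (g • s) x = evalFn U x g • s x := rfl

/-! ## Lattice-valued constant functions: the sections of `𝒪_X · S` -/

/-- **The sections of `𝒪_X · S` over `U`**: the functions `s : ↥U → V` that are CONSTANT and whose value
lies in the stalk lattice `𝒪_{X,x} · S` at every `x ∈ U` — a `Γ(X, U)`-submodule of the functions
`↥U → V`. [folklore] -/
def latticeSubmodule (U : X.Opens) : Submodule Γ(X, U) (U → V) where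
  carrier := {s | (∀ x y : U, s x = s y) ∧ ∀ x : U, s x ∈ stalkSpan V S x.1}
  zero_mem' := ⟨fun _ _ => rfl, fun x => (stalkSpan V S x.1).zero_mem⟩
  add_mem' {s t} hs ht :=
    ⟨fun x y => by rw [Pi.add_apply, Pi.add_apply, hs.1 x y, ht.1 x y],
      fun x => (stalkSpan V S x.1).add_mem (hs.2 x) (ht.2 x)⟩
  smul_mem' g s hs := by
    refine ⟨fun x y => ?_, fun x => ?_⟩
    · rw [fn_smul_apply, fn_smul_apply, hs.1 x y, evalFn_eq_evalFn U x y]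
    · rw [fn_smul_apply, evalFn_apply, ← stalk_smul_def]
      exact (stalkSpan V S x.1).smul_mem _ (hs.2 x)

/-- Membership in `latticeSubmodule`. [folklore] -/
theorem mem_latticeSubmodule_iff (U : X.Opens) (s : U → V) :
    s ∈ latticeSubmodule V S U ↔ (∀ x y : U, s x = s y) ∧ ∀ x : U, s x ∈ stalkSpan V S x.1 := Iff.rfl

/-- Restriction of lattice sections along `U' ≤ U` (restriction of functions). [folklore] -/
def latticeRestrict {U U' : X.Opens} (i : U' ≤ U) : latticeSubmodule V S U →+ latticeSubmodule V S U' where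
  toFun s := ⟨fun x => s.1 ⟨x.1, i x.2⟩, fun _ _ => s.2.1 _ _, fun x => s.2.2 ⟨x.1, i x.2⟩⟩
  map_zero' := rfl
  map_add' _ _ := rfl

/-- Components of a restricted section. [folklore] -/
@[simp]
theorem latticeRestrict_apply {U U' : X.Opens} (i : U' ≤ U) (s : latticeSubmodule V S U) (x : U') :
    (latticeRestrict V S i s).1 x = s.1 ⟨x.1, i x.2⟩ := rfl

/-- Restriction is semilinear over the restriction of functions. [folklore] -/
theorem latticeRestrict_smul {U U' : X.Opens} (i : U' ≤ U) (g : Γ(X, U)) (s : latticeSubmodule V S U) :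
    latticeRestrict V S i (g • s) = X.presheaf.map (homOfLE i).op g • latticeRestrict V S i s := by
  apply Subtype.ext
  funext x
  change (g • s.1) ⟨x.1, i x.2⟩ = (X.presheaf.map (homOfLE i).op g • (latticeRestrict V S i s).1) x
  rw [fn_smul_apply, fn_smul_apply, latticeRestrict_apply, evalFn_map]

/-! ## The presheaf and the sheaf condition -/

/-- The presheaf of abelian groups `U ↦ Γ(U, 𝒪_X · S)`. [folklore] -/
def generatedPresheafAb : TopCat.Presheaf Ab X where
  obj U := AddCommGrpCat.of (latticeSubmodule V S U.unop)
  map i := AddCommGrpCat.ofHom (latticeRestrict V S i.unop.le)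
  map_id U := by
    refine AddCommGrpCat.ext fun s => Subtype.ext (funext fun x => ?_)
    rfl
  map_comp i j := by
    refine AddCommGrpCat.ext fun s => Subtype.ext (funext fun x => ?_)
    rfl

/-- The restriction maps of `generatedPresheafAb`. [folklore] -/
@[simp]
theorem generatedPresheafAb_map_apply {U U' : (X.Opens)ᵒᵖ} (i : U ⟶ U') (s : latticeSubmodule V S U.unop) :
    ((generatedPresheafAb V S).map i) s = latticeRestrict V S i.unop.le s := rfl

/-- The presheaf of `𝒪_X`-modules `U ↦ Γ(U, 𝒪_X · S)`. [folklore] -/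
def generatedPresheaf : X.PresheafOfModules :=
  @PresheafOfModules.ofPresheaf _ _ X.ringCatSheaf.obj (generatedPresheafAb V S)
    (fun U => Submodule.module (latticeSubmodule V S U.unop))
    (fun _ _ i g s => latticeRestrict_smul V S i.unop.le g s)

/-- Two non-empty opens of the irreducible `X` meet. [folklore] -/
theorem exists_mem_inf {U U' : X.Opens} (x : U) (y : U') : ∃ z : X, z ∈ U ⊓ U' := by
  obtain ⟨z, hzU, hzU'⟩ := nonempty_preirreducible_inter U.isOpen U'.isOpen ⟨x.1, x.2⟩ ⟨y.1, y.2⟩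
  exact ⟨z, ⟨hzU, hzU'⟩⟩

/-- **`U ↦ Γ(U, 𝒪_X · S)` is a sheaf**: lattice sections glue uniquely (functions on points glue; the
glued function is constant because two non-empty opens of the irreducible `X` meet). [folklore] -/
theorem generatedPresheafAb_isSheaf : TopCat.Presheaf.IsSheaf (generatedPresheafAb (X := X) V S) := by
  classical
  rw [TopCat.Presheaf.isSheaf_iff_isSheafUniqueGluing]
  intro ι U sf hsf
  -- pointwise agreement of the pieces
  have hagree : ∀ (i j : ι) (x : X) (hi : x ∈ U i) (hj : x ∈ U j),
      (sf i).1 ⟨x, hi⟩ = (sf j).1 ⟨x, hj⟩ := by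
    intro i j x hi hj
    have h := congrArg (fun s : latticeSubmodule V S (U i ⊓ U j) => s.1 ⟨x, ⟨hi, hj⟩⟩) (hsf i j)
    simpa only [generatedPresheafAb_map_apply, latticeRestrict_apply] using h
  -- choice of a chart at each point of the union
  have hmem : ∀ x : ↥(iSup U), ∃ i, x.1 ∈ U i := fun x => Opens.mem_iSup.mp x.2
  choose idx hidx using hmem
  let t : ↥(iSup U) → V := fun x => (sf (idx x)).1 ⟨x.1, hidx x⟩
  have ht_apply : ∀ (x : ↥(iSup U)) (i : ι) (hi : x.1 ∈ U i), t x = (sf i).1 ⟨x.1, hi⟩ :=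
    fun x i hi => hagree _ _ _ _ _
  have ht : t ∈ latticeSubmodule V S (iSup U) := by
    refine ⟨fun x y => ?_, fun x => ?_⟩
    · obtain ⟨z, hz⟩ := exists_mem_inf (U := U (idx x)) (U' := U (idx y)) ⟨x.1, hidx x⟩ ⟨y.1, hidx y⟩
      have hzU : z ∈ iSup U := Opens.mem_iSup.mpr ⟨idx x, hz.1⟩
      calc t x = (sf (idx x)).1 ⟨x.1, hidx x⟩ := rfl
        _ = (sf (idx x)).1 ⟨z, hz.1⟩ := (sf (idx x)).2.1 _ _
        _ = t ⟨z, hzU⟩ := (ht_apply ⟨z, hzU⟩ (idx x) hz.1).symm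
        _ = (sf (idx y)).1 ⟨z, hz.2⟩ := ht_apply ⟨z, hzU⟩ (idx y) hz.2
        _ = (sf (idx y)).1 ⟨y.1, hidx y⟩ := (sf (idx y)).2.1 _ _
        _ = t y := rfl
    · exact (sf (idx x)).2.2 ⟨x.1, hidx x⟩
  refine ⟨⟨t, ht⟩, fun i => Subtype.ext (funext fun x => ?_), ?_⟩
  · simp only [generatedPresheafAb_map_apply, latticeRestrict_apply]
    exact ht_apply ⟨x.1, _⟩ i x.2
  · intro s hs
    refine Subtype.ext (funext fun x => ?_)
    have h := congrArg (fun s : latticeSubmodule V S (U (idx x)) => s.1 ⟨x.1, hidx x⟩) (hs (idx x))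
    simpa only [generatedPresheafAb_map_apply, latticeRestrict_apply] using h

/-- **`𝒪_X · S`, the `𝒪_X`-submodule of the constant sheaf `V_X` generated by `S ⊆ V`**, as a sheaf of
`𝒪_X`-modules (`X.Modules`). For `V = K(X)^r`, `S = φ(M)` this is the FULL SHEAF `M~ = π^*M/torsion`
of Artin–Verdier; for `V = K(X)`, `S` the image of an ideal `I ⊆ T`, the ideal sheaf `I·𝒪_X`.
[cite: ArtinVerdier1985, p. 79] -/
def generatedSheaf : X.Modules where
  val := generatedPresheaf V S
  isSheaf := generatedPresheafAb_isSheaf V S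

/-! ## Sections of `𝒪_X · S` -/

/-- The underlying function `↥U → V` of a section of `𝒪_X · S` over `U`. [folklore] -/
def fn {U : X.Opens} (s : Γ(generatedSheaf V S, U)) : U → V :=
  (s : latticeSubmodule V S U).1

/-- Sections are determined by their functions. [folklore] -/
theorem section_ext {U : X.Opens} {s s' : Γ(generatedSheaf V S, U)} (h : fn V S s = fn V S s') : s = s' :=
  Subtype.ext h

/-- The function of a section is constant. [folklore] -/
theorem fn_apply_eq_fn_apply {U : X.Opens} (s : Γ(generatedSheaf V S, U)) (x y : U) :
    fn V S s x = fn V S s y :=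
  (s : latticeSubmodule V S U).2.1 x y

/-- The value of a section at `x` lies in the stalk lattice `𝒪_{X,x} · S`. [folklore] -/
theorem fn_mem_stalkSpan {U : X.Opens} (s : Γ(generatedSheaf V S, U)) (x : U) :
    fn V S s x ∈ stalkSpan V S x.1 :=
  (s : latticeSubmodule V S U).2.2 x

/-- Restriction of sections restricts the function. [folklore] -/
@[simp]
theorem fn_map {U U' : X.Opens} (i : U' ⟶ U) (s : Γ(generatedSheaf V S, U)) (x : U') :
    fn V S ((generatedSheaf V S).presheaf.map i.op s) x = fn V S s ⟨x.1, i.le x.2⟩ := rfl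

/-- `fn` is additive. [folklore] -/
@[simp]
theorem fn_add {U : X.Opens} (s s' : Γ(generatedSheaf V S, U)) : fn V S (s + s') = fn V S s + fn V S s' := rfl

/-- `fn` of zero. [folklore] -/
@[simp]
theorem fn_zero {U : X.Opens} : fn V S (0 : Γ(generatedSheaf V S, U)) = 0 := rfl

/-- `fn` of a scalar multiple: `(g • s)(x) = g(x) • s(x)`. [folklore] -/
theorem fn_smul {U : X.Opens} (g : Γ(X, U)) (s : Γ(generatedSheaf V S, U)) (x : U) :
    fn V S (g • s) x = evalFn U x g • fn V S s x := rfl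

/-- **The section with constant value `v`** over `U`, for `v ∈ V` lying in `𝒪_{X,x} · S` at every `x ∈ U`.
[folklore] -/
def mkSection (U : X.Opens) (v : V) (hv : ∀ x ∈ U, v ∈ stalkSpan V S x) : Γ(generatedSheaf V S, U) :=
  (⟨fun _ => v, fun _ _ => rfl, fun x => hv x.1 x.2⟩ : latticeSubmodule V S U)

/-- The function of `mkSection U v _` is constant `v`. [folklore] -/
@[simp]
theorem fn_mkSection (U : X.Opens) (v : V) (hv : ∀ x ∈ U, v ∈ stalkSpan V S x) (x : U) :
    fn V S (mkSection V S U v hv) x = v := rfl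

/-- Every section over an open containing `x` is `mkSection` of its value at `x`. [folklore] -/
theorem eq_mkSection {U : X.Opens} (s : Γ(generatedSheaf V S, U)) (x : U) :
    s = mkSection V S U (fn V S s x)
      (fun y hy => fn_apply_eq_fn_apply V S s x ⟨y, hy⟩ ▸ fn_mem_stalkSpan V S s ⟨y, hy⟩) :=
  section_ext V S (funext fun y => fn_apply_eq_fn_apply V S s y x)

/-- Elements of `S` give global sections. [folklore] -/
def ofMem (U : X.Opens) (v : V) (hv : v ∈ S) : Γ(generatedSheaf V S, U) :=
  mkSection V S U v fun x _ => subset_stalkSpan V S x hv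

/-- The function of `ofMem`. [folklore] -/
@[simp]
theorem fn_ofMem (U : X.Opens) (v : V) (hv : v ∈ S) (x : U) : fn V S (ofMem V S U v hv) x = v := rfl

/-- Over an open containing a point `x`, sections of `𝒪_X · S` are the same as vectors lying in every
stalk lattice along `U`: the value map is injective. [folklore] -/
theorem fn_apply_injective {U : X.Opens} (x : U) :
    Function.Injective fun s : Γ(generatedSheaf V S, U) => fn V S s x := by
  intro s s' h
  refine section_ext V S (funext fun y => ?_)
  rw [fn_apply_eq_fn_apply V S s y x, fn_apply_eq_fn_apply V S s' y x]
  exact h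

/-- The range of the value map at `x ∈ U`: exactly the vectors in `⋂_{y ∈ U} 𝒪_{X,y} · S`. [folklore] -/
theorem range_fn_apply {U : X.Opens} (x : U) :
    Set.range (fun s : Γ(generatedSheaf V S, U) => fn V S s x) = ⋂ y : U, (stalkSpan V S y.1 : Set V) := by
  ext v
  simp only [Set.mem_range, Set.mem_iInter, SetLike.mem_coe]
  constructor
  · rintro ⟨s, rfl⟩ y
    rw [fn_apply_eq_fn_apply V S s x y]
    exact fn_mem_stalkSpan V S s y
  · intro hv
    exact ⟨mkSection V S U v fun y hy => hv ⟨y, hy⟩, rfl⟩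

end Summit.ResolutionOfSingularities.ResolutionOfSingularities.Theorems.NoZeno.SandwichCluster.FullSheaf

end
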